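import Mathlib
import HarnessLib
import Summits.KontsevichZagierPeriods.KontsevichZagierPeriods.Theorems.LinRedNormalFormDihedralNormalFormStubAtomReductionAux1
import Summits.KontsevichZagierPeriods.KontsevichZagierPeriods.Theorems.LinRedNormalFormDihedralNormalFormStubAtomReductionAux2
import Summits.KontsevichZagierPeriods.KontsevichZagierPeriods.Theorems.LinRedNormalFormDihedralNormalFormStubAtomReductionAux3

/-!
# Stub `stub_atomReduction`, tools IV: the domination lemma

Registered sub-goal of this file: `stub_atomReduction_domination`.

**Domination lemma** (`integrableOn_monomial_mul_weightV`, in the picture `v = 1 - x` of the open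
cube). Let `P ∈ ℝ[v₁, …, v_k]`, `d ∈ ℕᵏ`, and a finite family of non-empty sets of coordinates
`Iₐ` with integer exponents `γₐ`; put `W(v) = ∏ (1 - vₗ)^{dₗ} · ∏ₐ (1 - ∏_{l ∈ Iₐ} (1 - vₗ))^{γₐ}`.
If `P · W` is absolutely integrable on the open cube then so is `v^ν · W` for EVERY monomial `v^ν`
of `P`: an absolutely convergent integrand splits into termwise absolutely convergent atoms.

Proof (an elementary replacement of Brown's Lemma 7.4): cover the cube by the order sectors
`v_{π 0} > v_{π 1} > ⋯` (tools II); in the nested chart `v_{π j} = y₀ ⋯ yⱼ` of a sector every chord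
is comparable to a monomial (`yⱼ ≤ chord ≤ |I| · yⱼ`, `le_chordV`, `chordV_le_sum`), `v^ν` is the
monomial `y^{L ν}` with `L` injective (`expL_injective`), so `P` becomes the polynomial
`R_π = ∑ c_ν y^{L ν}` (`eval_chartPoly`) and `W · Jacobian` is squeezed between constant multiples
of a Laurent monomial `y^Γ`. The lowest-power lemma (tools I) applied to `|R_π| · y^Γ` on the half
cube gives `(L ν)ᵢ + Γᵢ > -1` for every monomial of `R_π`, whence `y^{L ν + Γ}` is integrable on
the whole cube and dominates `v^ν · W · Jacobian` there.

Recurring terms are written through parse-time notations (`CP⟪⟫`, `ATOM⟪⟫`, `SEC⟪⟫`, `NC⟪⟫`,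
`CHORD⟪⟫`, `WEIGHT⟪⟫`, `EXPL⟪⟫`, `CPOLY⟪⟫`, `DIAG⟪⟫`, …); the files introduce no definitions.
-/

noncomputable section

open MeasureTheory Set MvPolynomial Filter Topology

namespace Summit.KontsevichZagierPeriods.DihedralNormalForm.TorusDescent.AtomReduction

open Summit.KontsevichZagierPeriods.MzvKernelInKZ
open Summit.KontsevichZagierPeriods.FurushoPentagon.HoffmanRelationInKZ
  (hasFDerivAt_monomialChart det_monomialChart)

/-! ### Notation (parse-time abbreviations; no definitions are introduced) -/

set_option quotPrecheck false

local notation "SEC⟪" k ", " π "⟫" =>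
  ({v : Fin k → ℝ | (∀ i, v i ∈ Set.Ioo (0:ℝ) 1) ∧ StrictAnti fun j => v (π j)} : Set (Fin k → ℝ))
local notation "NC⟪" k ", " π ", " y "⟫" =>
  (Summit.KontsevichZagierPeriods.MzvKernelInKZ.TwoPosets.cubicalMap k y ∘ (Equiv.symm π))
local notation "CHORD⟪" I ", " v "⟫" => ((1:ℝ) - ∏ l ∈ I, (1 - v l))
local notation "WEIGHT⟪" I ", " γ ", " d ", " v "⟫" =>
  ((∏ l, (1 - v l) ^ (d l : ℕ)) * ∏ a, CHORD⟪I a, v⟫ ^ (γ a : ℤ))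
local notation "EXPL⟪" π ", " ν "⟫" =>
  (Finsupp.equivFunOnFinite.symm fun i => ∑ j ∈ Finset.univ.filter (fun j => i ≤ j), ν (π j))
local notation "CPOLY⟪" π ", " P "⟫" =>
  (∑ ν ∈ MvPolynomial.support P, MvPolynomial.monomial EXPL⟪π, ν⟫ (MvPolynomial.coeff ν P))

set_option quotPrecheck true

/-! ### Chords in the `v = 1 - x` picture -/

section Chords

variable {k : ℕ}

/-- Lower bound: a chord dominates each of its coordinates. -/
theorem le_chordV {I : Finset (Fin k)} {v : Fin k → ℝ} (hv : ∀ l, 0 ≤ v l ∧ v l ≤ 1)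
    {m : Fin k} (hm : m ∈ I) : v m ≤ CHORD⟪I, v⟫ := by
  rw [← Finset.mul_prod_erase I (fun l => 1 - v l) hm]
  have h1 : ∏ l ∈ I.erase m, (1 - v l) ≤ 1 :=
    Finset.prod_le_one (fun l _ => by linarith [(hv l).2]) fun l _ => by linarith [(hv l).1]
  have : (1 - v m) * ∏ l ∈ I.erase m, (1 - v l) ≤ (1 - v m) * 1 :=
    mul_le_mul_of_nonneg_left h1 (by linarith [(hv m).2])
  linarith

/-- Upper bound: a chord is at most the sum of its coordinates. -/
theorem chordV_le_sum {I : Finset (Fin k)} {v : Fin k → ℝ} (hv : ∀ l, 0 ≤ v l ∧ v l ≤ 1) :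
    CHORD⟪I, v⟫ ≤ ∑ l ∈ I, v l := by
  classical
  induction I using Finset.induction_on with
  | empty => simp
  | insert a s ha ih =>
    rw [Finset.prod_insert ha, Finset.sum_insert ha]
    have h0 : 0 ≤ ∏ l ∈ s, (1 - v l) := Finset.prod_nonneg fun l _ => by linarith [(hv l).2]
    have h1 : ∏ l ∈ s, (1 - v l) ≤ 1 :=
      Finset.prod_le_one (fun l _ => by linarith [(hv l).2]) fun l _ => by linarith [(hv l).1]
    have h2 : v a * ∏ l ∈ s, (1 - v l) ≤ v a * 1 := mul_le_mul_of_nonneg_left h1 (hv a).1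
    nlinarith [(hv a).1, (hv a).2]

/-- A chord is at most `1`. -/
theorem chordV_le_one {I : Finset (Fin k)} {v : Fin k → ℝ} (hv : ∀ l, 0 ≤ v l ∧ v l ≤ 1) :
    CHORD⟪I, v⟫ ≤ 1 := by
  linarith [Finset.prod_nonneg (s := I) (f := fun l => 1 - v l) fun l _ => by linarith [(hv l).2]]

end Chords

/-! ### The domination lemma -/

section Domination

variable {k : ℕ} {ι : Type*} [Fintype ι]

/-- The exponent transform of the nested chart of `π`, `(L ν)ᵢ = ∑_{j ≥ i} ν (π j)` (so that
`v^ν = y^{L ν}` for `v (π j) = y₀ ⋯ yⱼ`), evaluated. -/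
theorem expL_apply (π : Equiv.Perm (Fin k)) (ν : Fin k →₀ ℕ) (i : Fin k) :
    EXPL⟪π, ν⟫ i = ∑ j ∈ Finset.univ.filter (fun j => i ≤ j), ν (π j) := by
  simp

/-- `expL π` is injective. -/
theorem expL_injective (π : Equiv.Perm (Fin k)) : Function.Injective fun ν : Fin k →₀ ℕ => EXPL⟪π, ν⟫ := by
  intro ν ν' h
  have h' : (fun j => ν (π j)) = fun j => ν' (π j) :=
    eq_of_forall_sum_filter_le_eq fun i => by
      have := congrArg (fun f : Fin k →₀ ℕ => f i) h
      simpa using this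
  ext l
  have := congrFun h' (π.symm l)
  simpa using this

/-- The monomial identity of the nested chart: `∏ₗ vₗ^{νₗ} = ∏ᵢ yᵢ^{(L ν)ᵢ}`. -/
theorem prod_nestedChart_pow (π : Equiv.Perm (Fin k)) (ν : Fin k →₀ ℕ) (y : Fin k → ℝ) :
    ∏ l, NC⟪k, π, y⟫ l ^ ν l = ∏ i, y i ^ EXPL⟪π, ν⟫ i := by
  rw [← Equiv.prod_comp π (fun l => NC⟪k, π, y⟫ l ^ ν l)]
  simp only [nestedChart_apply_perm, expL_apply]
  exact prod_pprod_pow (fun j => ν (π j)) y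

/-- `R_π(y) = P(v(y))` along the nested chart. -/
theorem eval_chartPoly (π : Equiv.Perm (Fin k)) (P : MvPolynomial (Fin k) ℝ) (y : Fin k → ℝ) :
    eval y (CPOLY⟪π, P⟫) = eval (NC⟪k, π, y⟫) P := by
  rw [map_sum, MvPolynomial.eval_eq' (NC⟪k, π, y⟫) P]
  refine Finset.sum_congr rfl fun ν _ => ?_
  rw [eval_monomial, Finsupp.prod_fintype _ _ fun i => pow_zero _, prod_nestedChart_pow]

/-- The coefficients of `R_π` are those of `P`, transported along the injective `expL π`. -/
theorem coeff_chartPoly (π : Equiv.Perm (Fin k)) (P : MvPolynomial (Fin k) ℝ) (ν : Fin k →₀ ℕ) :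
    coeff (EXPL⟪π, ν⟫) (CPOLY⟪π, P⟫) = coeff ν P := by
  classical
  rw [coeff_sum]
  simp only [coeff_monomial]
  rw [Finset.sum_eq_single ν]
  · rw [if_pos rfl]
  · intro ν' _ hne
    rw [if_neg fun h => hne (expL_injective π h)]
  · intro hν
    rw [if_pos rfl]
    exact notMem_support_iff.1 hν

/-- The weight is measurable. -/
theorem measurable_weightV (I : ι → Finset (Fin k)) (γ : ι → ℤ) (d : Fin k → ℕ) :
    Measurable ((fun v : Fin _ → ℝ => WEIGHT⟪I, γ, d, v⟫)) := by
  refine Measurable.mul (Finset.measurable_prod _ fun l _ => ?_)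
    (Finset.measurable_prod _ fun a _ => ?_)
  · exact (measurable_const.sub (measurable_pi_apply l)).pow_const _
  · exact (measurable_const.sub (Finset.measurable_prod _ fun l _ =>
      measurable_const.sub (measurable_pi_apply l))).pow_const _

/-- The weight is non-negative on the open cube. -/
theorem weightV_nonneg (I : ι → Finset (Fin k)) (hI : ∀ a, (I a).Nonempty) (γ : ι → ℤ)
    (d : Fin k → ℕ) {v : Fin k → ℝ} (hv : ∀ l, v l ∈ Ioo (0:ℝ) 1) : 0 ≤ WEIGHT⟪I, γ, d, v⟫ := by
  have hv01 : ∀ l, 0 ≤ v l ∧ v l ≤ 1 := fun l => ⟨(hv l).1.le, (hv l).2.le⟩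
  refine mul_nonneg (Finset.prod_nonneg fun l _ => pow_nonneg (by linarith [(hv l).2]) _)
    (Finset.prod_nonneg fun a _ => (zpow_pos ?_ _).le)
  obtain ⟨m, hm⟩ := hI a
  exact (hv m).1.trans_le (le_chordV hv01 hm)

/-- **The domination lemma** (in the `v = 1 - x` picture). If `P(v) · (1 - v)^d · ∏ₐ chordₐ^{γₐ}`
is absolutely integrable on the open cube, then so is `v^ν · (1 - v)^d · ∏ₐ chordₐ^{γₐ}` for every
monomial `v^ν` of `P`. -/
theorem integrableOn_monomial_mul_weightV (I : ι → Finset (Fin k)) (hI : ∀ a, (I a).Nonempty)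
    (γ : ι → ℤ) (d : Fin k → ℕ) (P : MvPolynomial (Fin k) ℝ)
    (hP : IntegrableOn (fun v => eval v P * WEIGHT⟪I, γ, d, v⟫)
      {x : Fin k → ℝ | ∀ i, x i ∈ Ioo (0:ℝ) 1}) :
    ∀ ν ∈ P.support, IntegrableOn (fun v => (∏ l, v l ^ ν l) * WEIGHT⟪I, γ, d, v⟫)
      {x : Fin k → ℝ | ∀ i, x i ∈ Ioo (0:ℝ) 1} := by
  classical
  intro ν₀ hν₀
  -- dimension zero: everything is integrable
  rcases Nat.eq_zero_or_pos k with rfl | hk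
  · have : IsFiniteMeasure (volume : Measure (Fin 0 → ℝ)) := by
      rw [volume_pi, Measure.pi_of_empty]; infer_instance
    have hconst : (fun v : Fin 0 → ℝ => (∏ l, v l ^ ν₀ l) * WEIGHT⟪I, γ, d, v⟫) =
        fun _ => WEIGHT⟪I, γ, d, (fun i => i.elim0)⟫ := by
      funext v
      rw [Subsingleton.elim v (fun i => i.elim0)]
      simp
    rw [hconst]
    exact integrableOn_const
  obtain ⟨n, rfl⟩ : ∃ n, k = n + 1 := ⟨k - 1, by omega⟩
  apply integrableOn_cube_of_forall_sector
  intro π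
  rw [integrableOn_sector_iff]
  -- data of the sector
  set jI : ι → Fin (n + 1) := fun a => ((I a).image π.symm).min' ((hI a).image _) with hjI
  set E : Fin (n + 1) → ℤ := fun i => ∑ a ∈ Finset.univ.filter (fun a => i ≤ jI a), γ a with hE
  obtain ⟨Γ, hΓ⟩ : ∃ Γ : Fin (n + 1) → ℤ, ∀ i, Γ i = ((n + 1 - 1 - (i : ℕ) : ℕ) : ℤ) + E i :=
    ⟨_, fun _ => rfl⟩
  obtain ⟨D, hD⟩ : ∃ D : Fin (n + 1) → ℤ, ∀ i, D i = (EXPL⟪π, ν₀⟫ i : ℤ) + Γ i := ⟨_, fun _ => rfl⟩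
  set cst : ι → ℝ := fun a => ((I a).card : ℝ) ^ (γ a).natAbs with hcst
  set Kup : ℝ := ∏ a, cst a with hKup
  set κ₁ : ℝ := ∏ l : Fin (n + 1), (1 / 2 : ℝ) ^ d l with hκ₁
  have hcst1 : ∀ a, 1 ≤ cst a := fun a =>
    one_le_pow₀ (by exact_mod_cast (hI a).card_pos)
  have hcst0 : ∀ a, 0 < cst a := fun a => one_pos.trans_le (hcst1 a)
  have hKup0 : 0 < Kup := Finset.prod_pos fun a _ => hcst0 a
  have hKupinv : ∏ a, (cst a)⁻¹ = Kup⁻¹ := by rw [hKup, Finset.prod_inv_distrib]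
  have hκ₁0 : 0 < κ₁ := Finset.prod_pos fun l _ => pow_pos (by norm_num) _
  set κ : ℝ := κ₁ * Kup⁻¹ with hκ
  have hκ0 : 0 < κ := mul_pos hκ₁0 (inv_pos.2 hKup0)
  -- facts along the chart, for `y` in the cube
  have hπjI : ∀ a, π (jI a) ∈ I a := by
    intro a
    have := Finset.min'_mem ((I a).image π.symm) ((hI a).image _)
    rw [Finset.mem_image] at this
    obtain ⟨l, hl, hl'⟩ := this
    have : π (jI a) = l := by rw [hjI]; simp only; rw [← hl', Equiv.apply_symm_apply]
    rw [this]; exact hl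
  have hjIle : ∀ a, ∀ l ∈ I a, jI a ≤ π.symm l := fun a l hl =>
    Finset.min'_le _ _ (Finset.mem_image_of_mem _ hl)
  have key : ∀ y : Fin (n + 1) → ℝ, (∀ i, y i ∈ Ioo (0:ℝ) 1) →
      (∀ l, NC⟪(n + 1), π, y⟫ l ∈ Ioo (0:ℝ) 1) ∧
      (∀ l, NC⟪(n + 1), π, y⟫ l ≤ y 0) ∧
      (∀ a, (cst a)⁻¹ * (NC⟪(n + 1), π, y⟫ (π (jI a))) ^ γ a ≤
          CHORD⟪(I a), (NC⟪(n + 1), π, y⟫)⟫ ^ γ a ∧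
        CHORD⟪(I a), (NC⟪(n + 1), π, y⟫)⟫ ^ γ a ≤
          cst a * (NC⟪(n + 1), π, y⟫ (π (jI a))) ^ γ a) ∧
      (∏ a, (NC⟪(n + 1), π, y⟫ (π (jI a))) ^ γ a) * ∏ j, y j ^ (n + 1 - 1 - (j : ℕ)) =
        ∏ i, y i ^ Γ i := by
    intro y hy
    set v := NC⟪(n + 1), π, y⟫ with hv_def
    obtain ⟨hv, hanti⟩ := nestedChart_mem_sector π hy
    have hmono := hanti.antitone
    have hv01 : ∀ l, 0 ≤ v l ∧ v l ≤ 1 := fun l => ⟨(hv l).1.le, (hv l).2.le⟩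
    have hy0 : ∀ i, y i ≠ 0 := fun i => (hy i).1.ne'
    refine ⟨hv, fun l => ?_, fun a => ?_, ?_⟩
    · have h1 : v l = v (π (π.symm l)) := by rw [Equiv.apply_symm_apply]
      have h2 : v (π (π.symm l)) ≤ v (π 0) := hmono (Fin.zero_le _)
      have h3 : v (π 0) = y 0 := by
        rw [hv_def, nestedChart_apply_perm]
        have : Finset.univ.filter (fun i : Fin (n + 1) => i ≤ 0) = {0} := by
          ext i; simp
        rw [this, Finset.prod_singleton]
      linarith
    · -- two-sided chord bound
      have hY : 0 < v (π (jI a)) := (hv _).1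
      have hlow : v (π (jI a)) ≤ CHORD⟪(I a), v⟫ := le_chordV hv01 (hπjI a)
      have hup : CHORD⟪(I a), v⟫ ≤ (I a).card * v (π (jI a)) := by
        refine (chordV_le_sum hv01).trans ?_
        have : ∀ l ∈ I a, v l ≤ v (π (jI a)) := fun l hl => by
          have h1 : v l = v (π (π.symm l)) := by rw [Equiv.apply_symm_apply]
          rw [h1]; exact hmono (hjIle a l hl)
        calc ∑ l ∈ I a, v l ≤ ∑ _l ∈ I a, v (π (jI a)) := Finset.sum_le_sum this
          _ = (I a).card * v (π (jI a)) := by rw [Finset.sum_const, nsmul_eq_mul]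
      have hc1 : (1 : ℝ) ≤ (I a).card := by exact_mod_cast (hI a).card_pos
      exact zpow_two_sided hY hlow hup hc1 (γ a)
    · -- exponent bookkeeping
      have h1 : ∏ a, (v (π (jI a))) ^ γ a = ∏ i, y i ^ E i := by
        simp only [hv_def, nestedChart_apply_perm]
        exact prod_pprod_zpow jI γ y hy0
      rw [h1, ← Finset.prod_mul_distrib]
      refine Finset.prod_congr rfl fun i _ => ?_
      rw [hΓ i, zpow_add₀ (hy0 i) (((n + 1 - 1 - (i : ℕ) : ℕ) : ℤ)) (E i), zpow_natCast, mul_comm]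
  -- Step 1: integrability of `|R_π| · y^Γ` on the half box through the LOWER bound
  have hH := (integrableOn_sector_iff π _).1 (integrableOn_sector_of_cube hP π)
  have hbox : (Set.pi univ fun _ : Fin (n + 1) => Ioo (0:ℝ) (1 / 2)) ⊆
      {x : Fin (n + 1) → ℝ | ∀ i, x i ∈ Ioo (0:ℝ) 1} := fun y hy i =>
    ⟨(hy i (mem_univ _)).1, (hy i (mem_univ _)).2.trans (by norm_num)⟩
  have hR : IntegrableOn (fun y => |eval y (CPOLY⟪π, P⟫)| * ∏ l, y l ^ Γ l)
      (Set.pi univ fun _ : Fin (n + 1) => Ioo (0:ℝ) (1 / 2)) := by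
    have h1 := ((hH.mono_set hbox).norm).const_mul κ⁻¹
    refine Integrable.mono' h1 ?_ ?_
    · refine Measurable.aestronglyMeasurable ?_
      refine Measurable.mul ?_ (Finset.measurable_prod _ fun l _ =>
        (measurable_pi_apply l).pow_const _)
      exact (continuous_abs.comp (continuous_eval _)).measurable
    · refine ae_restrict_of_forall_mem (MeasurableSet.univ_pi fun _ => measurableSet_Ioo)
        fun y hy => ?_
      have hy' : ∀ i, y i ∈ Ioo (0:ℝ) 1 := hbox hy
      obtain ⟨hv, hvle, hch, hexp⟩ := key y hy'
      set v := NC⟪(n + 1), π, y⟫ with hv_def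
      have hy0 : ∀ i, 0 < y i := fun i => (hy' i).1
      have hyhalf : y 0 < 1 / 2 := (hy 0 (mem_univ _)).2
      have hJ : 0 ≤ ∏ j : Fin (n + 1), y j ^ (n + 1 - 1 - (j : ℕ)) :=
        Finset.prod_nonneg fun j _ => pow_nonneg (hy0 j).le _
      have hw1 : κ₁ ≤ ∏ l, (1 - v l) ^ d l := by
        refine Finset.prod_le_prod (fun l _ => pow_nonneg (by norm_num) _) fun l _ => ?_
        exact pow_le_pow_left₀ (by norm_num) (by linarith [hvle l]) _
      have hw2 : Kup⁻¹ * ∏ a, (v (π (jI a))) ^ γ a ≤ ∏ a, CHORD⟪(I a), v⟫ ^ γ a := by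
        rw [← hKupinv, ← Finset.prod_mul_distrib]
        exact Finset.prod_le_prod (fun a _ => mul_nonneg (inv_nonneg.2 (hcst0 a).le)
          (zpow_pos (hv _).1 _).le) fun a _ => (hch a).1
      have hwv : κ₁ * (Kup⁻¹ * ∏ a, (v (π (jI a))) ^ γ a) ≤ WEIGHT⟪I, γ, d, v⟫ := by
        exact mul_le_mul hw1 hw2 (mul_nonneg (inv_nonneg.2 hKup0.le)
          (Finset.prod_nonneg fun a _ => (zpow_pos (hv _).1 _).le))
          (Finset.prod_nonneg fun l _ => pow_nonneg (by linarith [(hv l).2]) _)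
      have hHy : κ * (|eval y (CPOLY⟪π, P⟫)| * ∏ l, y l ^ Γ l) ≤
          ‖eval v P * WEIGHT⟪I, γ, d, v⟫ * ∏ j, y j ^ (n + 1 - 1 - (j : ℕ))‖ := by
        rw [Real.norm_eq_abs, abs_mul, abs_mul, abs_of_nonneg (weightV_nonneg I hI γ d hv),
          abs_of_nonneg hJ, eval_chartPoly, ← hexp]
        calc κ * (|eval v P| * ((∏ a, v (π (jI a)) ^ γ a) * ∏ j, y j ^ (n + 1 - 1 - (j : ℕ))))
            = |eval v P| * (κ₁ * (Kup⁻¹ * ∏ a, (v (π (jI a))) ^ γ a)) *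
                ∏ j, y j ^ (n + 1 - 1 - (j : ℕ)) := by rw [hκ]; ring
          _ ≤ |eval v P| * WEIGHT⟪I, γ, d, v⟫ * ∏ j, y j ^ (n + 1 - 1 - (j : ℕ)) :=
              mul_le_mul_of_nonneg_right (mul_le_mul_of_nonneg_left hwv (abs_nonneg _)) hJ
      rw [Real.norm_of_nonneg (mul_nonneg (abs_nonneg _)
        (Finset.prod_nonneg fun l _ => (zpow_pos (hy0 l) _).le))]
      calc |eval y (CPOLY⟪π, P⟫)| * ∏ l, y l ^ Γ l
          = κ⁻¹ * (κ * (|eval y (CPOLY⟪π, P⟫)| * ∏ l, y l ^ Γ l)) := by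
            field_simp
        _ ≤ κ⁻¹ * ‖eval v P * WEIGHT⟪I, γ, d, v⟫ * ∏ j, y j ^ (n + 1 - 1 - (j : ℕ))‖ :=
            mul_le_mul_of_nonneg_left hHy (inv_nonneg.2 hκ0.le)
  -- Step 2: Lemma B
  have hB := neg_one_lt_of_integrableOn_abs_eval_mul (CPOLY⟪π, P⟫) Γ (by norm_num) hR
    (EXPL⟪π, ν₀⟫) (by
      rw [mem_support_iff, coeff_chartPoly]
      exact mem_support_iff.1 hν₀)
  have hDgt : ∀ i, -1 < D i := fun i => by
    rw [hD i]
    exact hB i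
  -- Step 3: UPPER bound and monomial integrability
  have hM := integrableOn_prod_zpow D hDgt
  refine Integrable.mono' (hM.const_mul Kup) ?_ ?_
  · refine Measurable.aestronglyMeasurable ?_
    refine Measurable.mul (Measurable.mul ?_ ((measurable_weightV I γ d).comp
      (measurable_nestedChart π))) (Finset.measurable_prod _ fun j _ =>
        (measurable_pi_apply j).pow_const _)
    exact Finset.measurable_prod _ fun l _ =>
      ((measurable_pi_apply l).comp (measurable_nestedChart π)).pow_const _
  · refine ae_restrict_of_forall_mem (measurableSet_cube (n + 1)) fun y hy => ?_
    obtain ⟨hv, hvle, hch, hexp⟩ := key y hy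
    set v := NC⟪(n + 1), π, y⟫ with hv_def
    have hy0 : ∀ i, 0 < y i := fun i => (hy i).1
    have hJ : 0 ≤ ∏ j : Fin (n + 1), y j ^ (n + 1 - 1 - (j : ℕ)) :=
      Finset.prod_nonneg fun j _ => pow_nonneg (hy0 j).le _
    have hmon : 0 ≤ ∏ l, v l ^ ν₀ l := Finset.prod_nonneg fun l _ => pow_nonneg (hv l).1.le _
    have hF0 : 0 ≤ (∏ l, v l ^ ν₀ l) * WEIGHT⟪I, γ, d, v⟫ * ∏ j, y j ^ (n + 1 - 1 - (j : ℕ)) :=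
      mul_nonneg (mul_nonneg hmon (weightV_nonneg I hI γ d hv)) hJ
    rw [Real.norm_of_nonneg hF0]
    have h1le : ∏ l, (1 - v l) ^ d l ≤ 1 :=
      Finset.prod_le_one (fun l _ => pow_nonneg (by linarith [(hv l).2]) _)
        fun l _ => pow_le_one₀ (by linarith [(hv l).2]) (by linarith [(hv l).1])
    have hwv : WEIGHT⟪I, γ, d, v⟫ ≤ Kup * ∏ a, (v (π (jI a))) ^ γ a := by
      calc (∏ l, (1 - v l) ^ d l) * ∏ a, CHORD⟪(I a), v⟫ ^ γ a
          ≤ 1 * ∏ a, (cst a * (v (π (jI a))) ^ γ a) :=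
            mul_le_mul h1le (Finset.prod_le_prod (fun a _ => (zpow_pos ((hv _).1.trans_le
              (le_chordV (fun l => ⟨(hv l).1.le, (hv l).2.le⟩) (hπjI a))) _).le)
              fun a _ => (hch a).2)
              (Finset.prod_nonneg fun a _ => (zpow_pos ((hv _).1.trans_le
                (le_chordV (fun l => ⟨(hv l).1.le, (hv l).2.le⟩) (hπjI a))) _).le) zero_le_one
        _ = Kup * ∏ a, (v (π (jI a))) ^ γ a := by rw [one_mul, Finset.prod_mul_distrib]
    calc (∏ l, v l ^ ν₀ l) * WEIGHT⟪I, γ, d, v⟫ * ∏ j, y j ^ (n + 1 - 1 - (j : ℕ))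
        ≤ (∏ l, v l ^ ν₀ l) * (Kup * ∏ a, (v (π (jI a))) ^ γ a) *
            ∏ j, y j ^ (n + 1 - 1 - (j : ℕ)) :=
          mul_le_mul_of_nonneg_right (mul_le_mul_of_nonneg_left hwv hmon) hJ
      _ = Kup * ((∏ i, y i ^ EXPL⟪π, ν₀⟫ i) *
            ((∏ a, (v (π (jI a))) ^ γ a) * ∏ j, y j ^ (n + 1 - 1 - (j : ℕ)))) := by
          rw [hv_def, prod_nestedChart_pow]; ring
      _ = Kup * ((∏ i, y i ^ EXPL⟪π, ν₀⟫ i) * ∏ i, y i ^ Γ i) := by rw [hexp]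
      _ = Kup * ∏ i, y i ^ D i := by
          congr 1
          rw [← Finset.prod_mul_distrib]
          refine Finset.prod_congr rfl fun i _ => ?_
          rw [hD i, zpow_add₀ (hy0 i).ne' ((EXPL⟪π, ν₀⟫ i : ℕ) : ℤ) (Γ i), zpow_natCast]

end Domination

/-- **Registered sub-goal `stub_atomReduction_domination`** (tools IV): the domination lemma. -/
theorem stub_atomReduction_domination : ∀ (k : ℕ) (ι : Type) [Fintype ι] (I : ι → Finset (Fin k)), (∀ a, (I a).Nonempty) → ∀ (γ : ι → ℤ) (d : Fin k → ℕ) (P : MvPolynomial (Fin k) ℝ), MeasureTheory.IntegrableOn (fun v : Fin k → ℝ => MvPolynomial.eval v P * ((∏ l, (1 - v l) ^ d l) * ∏ a, (1 - ∏ l ∈ I a, (1 - v l)) ^ γ a)) {x : Fin k → ℝ | ∀ i, x i ∈ Set.Ioo (0:ℝ) 1} MeasureTheory.volume → ∀ ν ∈ P.support, MeasureTheory.IntegrableOn (fun v : Fin k → ℝ => (∏ l, v l ^ ν l) * ((∏ l, (1 - v l) ^ d l) * ∏ a, (1 - ∏ l ∈ I a, (1 - v l)) ^ γ a)) {x : Fin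 k → ℝ | ∀ i, x i ∈ Set.Ioo (0:ℝ) 1} MeasureTheory.volume :=
  fun _ _ _ I hI γ d P hP => integrableOn_monomial_mul_weightV I hI γ d P hP

end Summit.KontsevichZagierPeriods.DihedralNormalForm.TorusDescent.AtomReduction
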